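import Literature.Computability.QuantumComplexity.AaronsonAmbainis
import Literature.Computability.QuantumComplexity.Symmetrization
import Literature.Computability.Complexity.BooleanFourier
import HarnessLib

/-!
# Influences of bounded low-degree polynomials: the Fourier formulas and `Σᵢ Infᵢ[p] ≤ 4 deg p`

Toolkit for Aaronson–Ambainis 2014, Thm. 21 (= Thm. 7 (i), `AaronsonAmbainisThm21.lean`): the
`L²` influences `influence i p = E_X[(p(X) - p(Xⁱ))²]` and the variance of
`AaronsonAmbainis.lean` expressed through the Fourier–Walsh coefficients of
`BooleanFourier.lean` (O'Donnell 2014, §2.2, Prop. 2.5 / Thm. 2.38 area, for real-valued `g`):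

* `cubeFourierCoeff_eq_zero_of_flipBit` — a function not depending on `x_j` has `ĝ(S) = 0`
  for `S ∋ j`; hence (`cubeFourierCoeff_evalBool_eq_zero`) **a polynomial of total degree `≤ d`
  has no Fourier weight above level `d`** (its value on the cube is a combination of monomials
  `∏_{i∈A} x_i`, `|A| ≤ d`; `card_support_le_degree` of `Symmetrization.lean`);
* `sum_sq_sum_mul_walsh` — `E_x[(Σ_S c_S χ_S(x))²] = Σ_S c_S²` (orthogonality);
* `influence_eq_sum_sq_fourier` — `Inf_i[p] = 4 Σ_{S ∋ i} p̂(S)²`;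
* `sum_influence_le` — for `p` of total degree `≤ d` with `0 ≤ p ≤ 1` on the cube,
  `Σ_i Inf_i[p] ≤ 4 d` (total influence `= 4 Σ_S |S| p̂(S)² ≤ 4 d Σ_S p̂(S)² = 4 d E[p²]`). This
  replaces, for the `L²` influences of the tree's `AAConjecture`, Aaronson–Ambainis' Lemma 19
  (`SumInf = O(T)` for the `L¹` influences, via Shi) in the proof of Thm. 21: with `d = 2T`
  (Beals et al., Lemma 4.2) the total `L²` influence of an acceptance polynomial is `≤ 8T`.

## References

* R. O'Donnell, *Analysis of Boolean Functions*, CUP 2014, §2.2 (influences, Prop. 2.5-style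
  Fourier formula `Inf_i[f] = Σ_{S∋i} f̂(S)²` for `±1`-valued `f`; for real `g` on `{0,1}^m` with
  `Inf_i = E[(g - g^{⊕i})²]` the constant is `4`), §1.4 (Parseval) [ODonnell2014].
* S. Aaronson, A. Ambainis, *The need for structure in quantum speedups*, Theory Comput. 10
  (2014), §3, Lemma 19 and proof of Thm. 21 (arXiv:0911.0996v3, pp. 13–14) [AaronsonAmbainis2014].
-/

noncomputable section

namespace Literature.Computability.QuantumComplexity

open Finset Literature.Computability.Complexity.LowDegree Literature.Probability.RandomGraphs.LowDegree

variable {N : ℕ}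

/-! ### Bit flips and characters -/

/-- Flipping bit `i` multiplies `χ_S` by `-1` if `i ∈ S` and leaves it unchanged otherwise. [folklore] -/
theorem walsh_flipBit (S : Finset (Fin N)) (i : Fin N) (x : Fin N → Bool) :
    walsh S (flipBit i x) = (if i ∈ S then -1 else 1) * walsh S x := by
  classical
  unfold walsh flipBit
  by_cases hi : i ∈ S
  · rw [if_pos hi, ← Finset.mul_prod_erase S _ hi, ← Finset.mul_prod_erase S (fun j => sgn (x j)) hi]
    have h1 : ∏ j ∈ S.erase i, sgn (Function.update x i (!x i) j) = ∏ j ∈ S.erase i, sgn (x j) :=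
      Finset.prod_congr rfl fun j hj => by rw [Function.update_of_ne (Finset.ne_of_mem_erase hj)]
    rw [h1, Function.update_self]
    cases x i <;> simp [sgn]
  · rw [if_neg hi, one_mul]
    exact Finset.prod_congr rfl fun j hj => by
      rw [Function.update_of_ne (ne_of_mem_of_not_mem hj hi)]

/-- `flipBit i` is an involution, so sums over the cube are invariant under it. [folklore] -/
theorem sum_flipBit (i : Fin N) (f : (Fin N → Bool) → ℝ) :
    ∑ x, f (flipBit i x) = ∑ x, f x :=
  Fintype.sum_bijective (flipBit i)
    (Function.Involutive.bijective fun x => flipBit_flipBit i x) _ _ fun _ => rfl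

/-- A function that does not depend on `x_j` has no Fourier weight on sets containing `j`. [cite: ODonnell2014, §2.2] -/
theorem cubeFourierCoeff_eq_zero_of_flipBit {g : (Fin N → Bool) → ℝ} {j : Fin N}
    (hg : ∀ x, g (flipBit j x) = g x) {S : Finset (Fin N)} (hj : j ∈ S) :
    cubeFourierCoeff g S = 0 := by
  unfold cubeFourierCoeff
  have h : ∑ x, g x * walsh S x = -∑ x, g x * walsh S x := by
    calc ∑ x, g x * walsh S x = ∑ x, g (flipBit j x) * walsh S (flipBit j x) :=
          (sum_flipBit j fun x => g x * walsh S x).symm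
      _ = ∑ x, -(g x * walsh S x) := Finset.sum_congr rfl fun x _ => by
          rw [hg, walsh_flipBit, if_pos hj]; ring
      _ = -∑ x, g x * walsh S x := Finset.sum_neg_distrib ..
  have h0 : ∑ x, g x * walsh S x = 0 := by linarith
  rw [h0, zero_div]

/-! ### Low-degree polynomials have no high Fourier coefficients -/

/-- The value on the cube of the monomial with exponent vector `m` depends only on the bits in
the support of `m`. [folklore] -/
theorem prod_pow_flipBit_eq {m : Fin N →₀ ℕ} {j : Fin N} (hj : j ∉ m.support) (x : Fin N → Bool) :
    (∏ i ∈ m.support, (if flipBit j x i then (1 : ℝ) else 0) ^ m i) =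
      ∏ i ∈ m.support, (if x i then (1 : ℝ) else 0) ^ m i :=
  Finset.prod_congr rfl fun i hi => by
    have hij : i ≠ j := fun h => hj (h ▸ hi)
    simp [flipBit, Function.update_of_ne hij]

/-- **A polynomial of total degree `≤ d` has no Fourier weight above level `d`**: if
`p.totalDegree ≤ d` and `|S| > d` then the coefficient of `χ_S` in `x ↦ p(x)` (`x ∈ {0,1}^N`)
vanishes. [cite: ODonnell2014, §1.2 (degree of the Fourier expansion)] -/
theorem cubeFourierCoeff_evalBool_eq_zero {p : MvPolynomial (Fin N) ℝ} {d : ℕ}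
    (hp : p.totalDegree ≤ d) {S : Finset (Fin N)} (hS : d < S.card) :
    cubeFourierCoeff (evalBool p) S = 0 := by
  classical
  -- expand `p(x)` over the monomials of `p`
  have hexp : ∀ x : Fin N → Bool, evalBool p x =
      ∑ m ∈ p.support, p.coeff m * ∏ i ∈ m.support, (if x i then (1 : ℝ) else 0) ^ m i := by
    intro x
    unfold evalBool
    rw [MvPolynomial.eval_eq]
  have hlin : cubeFourierCoeff (evalBool p) S =
      ∑ m ∈ p.support, p.coeff m *
        cubeFourierCoeff (fun x => ∏ i ∈ m.support, (if x i then (1 : ℝ) else 0) ^ m i) S := by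
    unfold cubeFourierCoeff
    simp_rw [hexp, Finset.sum_mul, mul_assoc]
    rw [Finset.sum_comm, Finset.sum_div]
    refine Finset.sum_congr rfl fun m _ => ?_
    rw [← Finset.mul_sum, mul_div_assoc]
  rw [hlin]
  refine Finset.sum_eq_zero fun m hm => ?_
  -- a monomial of `p` misses some `j ∈ S`
  have hdeg : m.support.card < S.card :=
    lt_of_le_of_lt ((card_support_le_degree m).trans ((MvPolynomial.le_totalDegree hm).trans hp)) hS
  obtain ⟨j, hjS, hjm⟩ := Finset.exists_mem_notMem_of_card_lt_card hdeg
  rw [cubeFourierCoeff_eq_zero_of_flipBit (fun x => prod_pow_flipBit_eq hjm x) hjS, mul_zero]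

/-! ### Influences through the Fourier expansion -/

/-- **Orthogonality, squared form**: `Σ_x (Σ_S c_S χ_S(x))² = 2^N Σ_S c_S²`. [cite: ODonnell2014, §1.4 (Parseval)] -/
theorem sum_sq_sum_mul_walsh (c : Finset (Fin N) → ℝ) :
    ∑ x : Fin N → Bool, (∑ S, c S * walsh S x) ^ 2 = 2 ^ N * ∑ S, c S ^ 2 := by
  calc ∑ x : Fin N → Bool, (∑ S, c S * walsh S x) ^ 2
      = ∑ x : Fin N → Bool, ∑ S, ∑ T, c S * c T * (walsh S x * walsh T x) := by
        refine Finset.sum_congr rfl fun x _ => ?_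
        rw [sq, Finset.sum_mul_sum]
        exact Finset.sum_congr rfl fun S _ => Finset.sum_congr rfl fun T _ => by ring
    _ = ∑ S, ∑ T, c S * c T * ∑ x : Fin N → Bool, walsh S x * walsh T x := by
        rw [Finset.sum_comm]
        refine Finset.sum_congr rfl fun S _ => ?_
        rw [Finset.sum_comm]
        exact Finset.sum_congr rfl fun T _ => by rw [Finset.mul_sum]
    _ = ∑ S, c S * c S * 2 ^ N := by
        refine Finset.sum_congr rfl fun S _ => ?_
        simp_rw [sum_walsh_mul_walsh_index]
        simp
    _ = 2 ^ N * ∑ S, c S ^ 2 := by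
        rw [Finset.mul_sum]
        exact Finset.sum_congr rfl fun S _ => by ring

/-- The difference `p(x) - p(xⁱ)` in the Walsh basis: `Σ_{S ∋ i} 2 p̂(S) χ_S(x)`. [cite: ODonnell2014, §2.2] -/
theorem evalBool_sub_evalBool_flipBit (p : MvPolynomial (Fin N) ℝ) (i : Fin N) (x : Fin N → Bool) :
    evalBool p x - evalBool p (flipBit i x) =
      ∑ S, (if i ∈ S then 2 * cubeFourierCoeff (evalBool p) S else 0) * walsh S x := by
  conv_lhs => rw [← sum_cubeFourierCoeff_mul_walsh (evalBool p) x,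
    ← sum_cubeFourierCoeff_mul_walsh (evalBool p) (flipBit i x)]
  rw [← Finset.sum_sub_distrib]
  refine Finset.sum_congr rfl fun S _ => ?_
  rw [walsh_flipBit]
  split_ifs <;> ring

/-- **`Inf_i[p] = 4 Σ_{S ∋ i} p̂(S)²`** for the `L²` influence of `AaronsonAmbainis.lean`. [cite: ODonnell2014, §2.2 (Fourier formula for influences)] -/
theorem influence_eq_sum_sq_fourier (i : Fin N) (p : MvPolynomial (Fin N) ℝ) :
    influence i p = 4 * ∑ S with i ∈ S, cubeFourierCoeff (evalBool p) S ^ 2 := by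
  unfold influence boolAvg
  simp_rw [evalBool_sub_evalBool_flipBit p i]
  rw [sum_sq_sum_mul_walsh, mul_div_cancel_left₀ _ (by positivity), Finset.sum_filter,
    Finset.mul_sum]
  refine Finset.sum_congr rfl fun S _ => ?_
  split_ifs <;> ring

/-- **Total influence in the Walsh basis**: `Σ_i Inf_i[p] = 4 Σ_S |S| p̂(S)²`. [cite: ODonnell2014, §2.2 (total influence)] -/
theorem sum_influence_eq (p : MvPolynomial (Fin N) ℝ) :
    ∑ i, influence i p = 4 * ∑ S : Finset (Fin N), (S.card : ℝ) * cubeFourierCoeff (evalBool p) S ^ 2 := by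
  simp_rw [influence_eq_sum_sq_fourier, Finset.sum_filter]
  rw [← Finset.mul_sum, Finset.sum_comm]
  congr 1
  refine Finset.sum_congr rfl fun S _ => ?_
  rw [Finset.sum_ite, Finset.sum_const_zero, add_zero, Finset.sum_const, nsmul_eq_mul]
  congr 2
  simp

/-- `E[p²] ≤ 1` for `0 ≤ p ≤ 1` on the cube, in Fourier terms: `Σ_S p̂(S)² ≤ 1`. [cite: ODonnell2014, §1.4 (Parseval)] -/
theorem sum_sq_fourier_le_one {p : MvPolynomial (Fin N) ℝ}
    (hb : ∀ x, 0 ≤ evalBool p x ∧ evalBool p x ≤ 1) :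
    ∑ S, cubeFourierCoeff (evalBool p) S ^ 2 ≤ 1 := by
  rw [sum_cubeFourierCoeff_sq, div_le_one (by positivity)]
  calc ∑ x, evalBool p x ^ 2 ≤ ∑ _x : Fin N → Bool, (1 : ℝ) :=
        Finset.sum_le_sum fun x _ => by
          have := hb x
          nlinarith
    _ = 2 ^ N := by simp

/-- **`Σ_i Inf_i[p] ≤ 4 d`** for a real polynomial `p` of total degree `≤ d` with `0 ≤ p ≤ 1` on
`{0,1}^N` (the `L²` substitute for Aaronson–Ambainis' Lemma 19 in the proof of Thm. 21:
`Σ_i Inf_i = 4 Σ_S |S| p̂(S)² ≤ 4 d Σ_S p̂(S)² = 4 d E[p²] ≤ 4 d`). [cite: AaronsonAmbainis2014, Lemma 19 and proof of Thm. 21 (L² form)] -/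
theorem sum_influence_le {p : MvPolynomial (Fin N) ℝ} {d : ℕ} (hp : p.totalDegree ≤ d)
    (hb : ∀ x, 0 ≤ evalBool p x ∧ evalBool p x ≤ 1) :
    ∑ i, influence i p ≤ 4 * d := by
  rw [sum_influence_eq]
  have hle : ∀ S : Finset (Fin N), (S.card : ℝ) * cubeFourierCoeff (evalBool p) S ^ 2 ≤
      d * cubeFourierCoeff (evalBool p) S ^ 2 := by
    intro S
    by_cases hS : d < S.card
    · rw [cubeFourierCoeff_evalBool_eq_zero hp hS]; simp
    · exact mul_le_mul_of_nonneg_right (by exact_mod_cast not_lt.1 hS) (sq_nonneg _)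
  calc 4 * ∑ S : Finset (Fin N), (S.card : ℝ) * cubeFourierCoeff (evalBool p) S ^ 2
      ≤ 4 * ∑ S : Finset (Fin N), (d : ℝ) * cubeFourierCoeff (evalBool p) S ^ 2 :=
        mul_le_mul_of_nonneg_left (Finset.sum_le_sum fun S _ => hle S) (by norm_num)
    _ = 4 * d * ∑ S, cubeFourierCoeff (evalBool p) S ^ 2 := by rw [← Finset.mul_sum, mul_assoc]
    _ ≤ 4 * d * 1 := mul_le_mul_of_nonneg_left (sum_sq_fourier_le_one hb) (by positivity)
    _ = 4 * d := mul_one _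

/-- Each influence is at most the total influence. [folklore] -/
theorem influence_le_sum_influence (i : Fin N) (p : MvPolynomial (Fin N) ℝ) :
    influence i p ≤ ∑ j, influence j p :=
  Finset.single_le_sum (fun j _ => influence_nonneg j p) (Finset.mem_univ i)

/-! ### Mean and variance through the Fourier expansion; Chebyshev -/

/-- `E[p] = p̂(∅)`. [cite: ODonnell2014, §1.2] -/
theorem boolAvg_evalBool_eq_fourier_empty (p : MvPolynomial (Fin N) ℝ) :
    boolAvg (evalBool p) = cubeFourierCoeff (evalBool p) ∅ := by
  rw [cubeFourierCoeff_empty]; rfl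

/-- **Chebyshev on the cube** (counting form): the number of `x ∈ {0,1}^N` with
`|p(x) - E[p]| > ε` is at most `Var[p] / ε² · 2^N`. [folklore] -/
theorem card_filter_deviation_le (p : MvPolynomial (Fin N) ℝ) {ε : ℝ} (hε : 0 < ε) :
    ((Finset.univ.filter fun x : Fin N → Bool => ε < |evalBool p x - boolAvg (evalBool p)|).card : ℝ)
      ≤ boolVariance p / ε ^ 2 * 2 ^ N := by
  unfold boolVariance boolAvg
  rw [div_mul_eq_mul_div, div_mul_cancel₀ _ (by positivity), le_div_iff₀ (by positivity)]
  set μ := (∑ x, evalBool p x) / (2 : ℝ) ^ N with hμ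
  calc (((Finset.univ.filter fun x : Fin N → Bool => ε < |evalBool p x - μ|).card : ℝ)) * ε ^ 2
      = ∑ x ∈ Finset.univ.filter (fun x : Fin N → Bool => ε < |evalBool p x - μ|), ε ^ 2 := by
        rw [Finset.sum_const, nsmul_eq_mul]
    _ ≤ ∑ x ∈ Finset.univ.filter (fun x : Fin N → Bool => ε < |evalBool p x - μ|),
          (evalBool p x - μ) ^ 2 := by
        refine Finset.sum_le_sum fun x hx => ?_
        have h := (Finset.mem_filter.1 hx).2
        have : ε ^ 2 < |evalBool p x - μ| ^ 2 := by gcongr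
        rw [sq_abs] at this
        exact this.le
    _ ≤ ∑ x, (evalBool p x - μ) ^ 2 :=
        Finset.sum_le_sum_of_subset_of_nonneg (Finset.filter_subset _ _) fun x _ _ => sq_nonneg _

end Literature.Computability.QuantumComplexity

end
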